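import Summits.ResolutionOfSingularities.ResolutionOfSingularities.Theorems.HomologicalConductorNoZenoPointBlowupSections
import Summits.ResolutionOfSingularities.ResolutionOfSingularities.Theorems.HomologicalConductorNoZenoSpecResidueField
import HarnessLib

/-!
# Crux `NoZenoR` (stmt-ResolutionOfSingularities-19943), slot 5 `stub_L1wCoreF3`, (B1) UP-5 (n2):
# `h⁰` OF A CLOSED POINT IS ITS RESIDUE DEGREE

OURS (cell res-hironaka, crux chain W4.4, seat res-L0-w44-stub-1 g12; planner DESK WORD 15/18 object (n2)).
Nothing here is a statement of the manuscript under review (Hironaka 2017); AI-written, weaker than expert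
review. Def-free, fact-free, `--supports 19943 --as helper`.

For `π : X → Spec S` and a CLOSED point `x ∈ X`, the reduced one-point subscheme `V(𝓘_{x})`
(`𝓘_{x} = vanishingIdeal {x}`) has global sections `κ(x)`, so Lipman's length
`h0 π 𝓘_{x} = length_S Γ(V(𝓘_{x}), 𝒪)` is `length_S κ(x)`, i.e. the residue degree `[κ(x) : κ(𝔪_S)]` when `x`
lies over the closed point of a local `S` (Mathlib `Scheme.Hom.residueDegree π x`, the joint currency of
`…NoZenoH0LeResidueDegree`). With UP-5a (`…PointBlowupRegularPoint.h0_comap_vanishingIdeal_point`: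
`h0 (ρ ≫ π) (𝓘_{x}·𝒪_{X'}) = h0 π 𝓘_{x}`) this computes `h⁰` of the node curve over `x`, and through
`Lipman1969_27_1_reg_rat`'s last-but-one clause the residue degree of the contracted point.

* §1 (affine open `W ∋ x`, `𝔭 = primeIdealOf x`): `mem_primeIdealOf_iff_notMem_basicOpen`,
  `ideal_vanishingIdeal_singleton` (`𝓘_{x}(W) = 𝔭`), `ker_evaluation_eq_primeIdealOf`,
  **`evaluation_surjective_of_isClosed`** (`Γ(X, W) → κ(x)` is onto for a closed point: `𝔭` is maximal).
* §2 **`h0_vanishingIdeal_singleton_eq_length`** — `h0 π 𝓘_{x} = length_S κ(x)` (`S` acting through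
  `S → Γ(X, 𝒪_X) → κ(x)`); **`length_residueField_eq_residueDegree`** — `length_S κ(x) = π.residueDegree x`
  for `x` over the closed point with `π.residueDegree x ≠ 0`; **`h0_vanishingIdeal_singleton_eq_residueDegree`**.

References: J. Lipman, Publ. Math. IHÉS 36 (1969) §10 p. 212 (`h⁰` as a length), §27 (27.1) (residual
degree of the contracted point) [`Lipman1969`] (context).
-/

noncomputable section

-- single-problem summit: the doubled namespace component `ResolutionOfSingularities` is forced
set_option linter.dupNamespace false

namespace Summit.ResolutionOfSingularities.ResolutionOfSingularities.Theorems.NoZeno.ExcCount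

open CategoryTheory AlgebraicGeometry Limits TopologicalSpace Topology Opposite IsLocalRing
open Literature.AlgebraicGeometry.Morphisms Literature.AlgebraicGeometry.Resolution
open Scheme.IdealSheafData

universe u

/-! ## §1 Evaluation at a closed point of an affine open -/

section Evaluation

variable {X : Scheme.{u}} {W : X.Opens} (hW : IsAffineOpen W) {x : X} (hxW : x ∈ W)

/-- `f ∈ 𝔭_x` iff `f(x) = 0`, i.e. iff `x ∉ D(f)` (`𝔭_x = primeIdealOf x`, the prime of `Γ(X, W)` at which
`𝒪_{X,x}` is the localization). [folklore] -/
theorem mem_primeIdealOf_iff_notMem_basicOpen (f : Γ(X, W)) :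
    f ∈ (hW.primeIdealOf ⟨x, hxW⟩).asIdeal ↔ x ∉ X.basicOpen f := by
  letI : Algebra Γ(X, W) (X.presheaf.stalk x) := TopCat.Presheaf.algebra_section_stalk X.presheaf ⟨x, hxW⟩
  haveI : IsLocalization.AtPrime (X.presheaf.stalk x) (hW.primeIdealOf ⟨x, hxW⟩).asIdeal :=
    hW.isLocalization_stalk ⟨x, hxW⟩
  rw [← IsLocalization.AtPrime.to_map_mem_maximal_iff (X.presheaf.stalk x)
    (hW.primeIdealOf ⟨x, hxW⟩).asIdeal f, IsLocalRing.mem_maximalIdeal, mem_nonunits_iff,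
    X.mem_basicOpen f x hxW]
  rfl

/-- On an affine open `W ∋ x`, the reduced ideal of the point is `𝓘_{x}(W) = 𝔭_x`. [folklore] -/
theorem ideal_vanishingIdeal_singleton (hx : IsClosed ({x} : Set X)) :
    (vanishingIdeal (⟨{x}, hx⟩ : Closeds X)).ideal ⟨W, hW⟩ = (hW.primeIdealOf ⟨x, hxW⟩).asIdeal := by
  rw [vanishingIdeal_ideal]
  have h : (hW.fromSpec.base ⁻¹' (((⟨{x}, hx⟩ : Closeds X)) : Set X)) = {hW.primeIdealOf ⟨x, hxW⟩} := by
    ext p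
    simp only [Closeds.coe_mk, Set.mem_preimage, Set.mem_singleton_iff]
    constructor
    · intro hp
      apply hW.fromSpec.isOpenEmbedding.injective
      rw [hp]
      exact (hW.fromSpec_primeIdealOf ⟨x, hxW⟩).symm
    · rintro rfl
      exact hW.fromSpec_primeIdealOf ⟨x, hxW⟩
  exact (congrArg PrimeSpectrum.vanishingIdeal h).trans (PrimeSpectrum.vanishingIdeal_singleton _)

/-- The kernel of the evaluation `Γ(X, W) → κ(x)` is `𝔭_x`. [folklore] -/
theorem ker_evaluation_eq_primeIdealOf :
    RingHom.ker (X.evaluation W x hxW).hom = (hW.primeIdealOf ⟨x, hxW⟩).asIdeal := by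
  ext f
  rw [RingHom.mem_ker, mem_primeIdealOf_iff_notMem_basicOpen hW hxW]
  exact X.evaluation_eq_zero_iff_notMem_basicOpen x hxW f

include hW in
/-- **Evaluation at a CLOSED point of an affine open is surjective**: `Γ(X, W) → κ(x)` is onto when
`{x}` is closed (`𝔭_x` is then maximal, so `Γ(X, W)/𝔭_x` is already the residue field of the local ring
`𝒪_{X,x} = Γ(X, W)_{𝔭_x}`). [folklore] -/
theorem evaluation_surjective_of_isClosed (hx : IsClosed ({x} : Set X)) :
    Function.Surjective (X.evaluation W x hxW) := by
  letI : Algebra Γ(X, W) (X.presheaf.stalk x) := TopCat.Presheaf.algebra_section_stalk X.presheaf ⟨x, hxW⟩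
  haveI : IsLocalization.AtPrime (X.presheaf.stalk x) (hW.primeIdealOf ⟨x, hxW⟩).asIdeal :=
    hW.isLocalization_stalk ⟨x, hxW⟩
  haveI hmax : (hW.primeIdealOf ⟨x, hxW⟩).asIdeal.IsMaximal :=
    hW.primeIdealOf_isMaximal_of_isClosed ⟨x, hxW⟩ hx
  intro c
  obtain ⟨t, rfl⟩ := X.residue_surjective x c
  obtain ⟨⟨a, s⟩, ht⟩ := IsLocalization.surj (hW.primeIdealOf ⟨x, hxW⟩).asIdeal.primeCompl t
  -- `s ∉ 𝔭_x` is invertible modulo the maximal ideal `𝔭_x`: `s * b - 1 ∈ 𝔭_x`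
  have hs : (s : Γ(X, W)) ∉ (hW.primeIdealOf ⟨x, hxW⟩).asIdeal := s.2
  obtain ⟨b, hb⟩ : ∃ b : Γ(X, W), s * b - 1 ∈ (hW.primeIdealOf ⟨x, hxW⟩).asIdeal := by
    obtain ⟨b, i, hi, hbi⟩ := hmax.exists_inv hs
    refine ⟨b, ?_⟩
    have : (s : Γ(X, W)) * b - 1 = -i := by rw [← hbi]; ring
    rw [this]
    exact ((hW.primeIdealOf ⟨x, hxW⟩).asIdeal).neg_mem hi
  refine ⟨a * b, ?_⟩
  -- in the stalk: `t * s = a`, `s * b = 1 + p` with `p ∈ 𝔭_x ↦ 𝔪_x`, so `residue t = residue (a * b)`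
  change (X.presheaf.germ W x hxW ≫ X.residue x) (a * b) = X.residue x t
  have hsb : X.residue x (X.presheaf.germ W x hxW (s * b)) = 1 := by
    have hmem : X.presheaf.germ W x hxW (s * b - 1) ∈ maximalIdeal (X.presheaf.stalk x) :=
      (IsLocalization.AtPrime.to_map_mem_maximal_iff (X.presheaf.stalk x)
        (hW.primeIdealOf ⟨x, hxW⟩).asIdeal _).mpr hb
    have h0 : X.residue x (X.presheaf.germ W x hxW (s * b - 1)) = 0 :=
      (IsLocalRing.residue_eq_zero_iff _).mpr hmem
    rw [map_sub, map_one, map_sub, map_one, sub_eq_zero] at h0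
    exact h0
  have ht' : t * X.presheaf.germ W x hxW s = X.presheaf.germ W x hxW a := ht
  rw [CategoryTheory.comp_apply]
  calc X.residue x (X.presheaf.germ W x hxW (a * b))
      = X.residue x (X.presheaf.germ W x hxW a) * X.residue x (X.presheaf.germ W x hxW b) := by
        rw [map_mul, map_mul]
    _ = X.residue x t * (X.residue x (X.presheaf.germ W x hxW (s * b))) := by
        rw [← ht', map_mul, map_mul, map_mul, mul_assoc]
    _ = X.residue x t := by rw [hsb, mul_one]

end Evaluation

/-! ## §2 `h⁰` of the reduced point and the residue degree -/

section Point

variable {S : Type u} [CommRing S] {X : Scheme.{u}} (π : X ⟶ Spec (.of S)) (x : X)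
  (hx : IsClosed ({x} : Set X))

/-- **`h0 π 𝓘_{x} = length_S κ(x)`** for a closed point `x` (`S` acting on `κ(x)` through
`S → Γ(X, 𝒪_X) → κ(x)`): the global sections of the reduced one-point subscheme `V(𝓘_{x})` are
`Γ(X, W)/𝓘_{x}(W) = Γ(X, W)/𝔭_x ≅ κ(x)` for any affine open `W ∋ x`
(`…PointBlowupSections.h0_eq_length_quotient`, `evaluation_surjective_of_isClosed`). [this work] -/
theorem h0_vanishingIdeal_singleton_eq_length :
    letI : Algebra S (X.residueField x) := ((X.Γevaluation x).hom.comp (algebraMapΓ π)).toAlgebra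
    h0 π (vanishingIdeal ⟨{x}, hx⟩) = Module.length S (X.residueField x) := by
  letI algK : Algebra S (X.residueField x) := ((X.Γevaluation x).hom.comp (algebraMapΓ π)).toAlgebra
  obtain ⟨W, hW, hxW, -⟩ :=
    exists_isAffineOpen_mem_and_subset (X := X) (x := x) (U := ⊤) (Opens.mem_top x)
  have hJW : ((vanishingIdeal (⟨{x}, hx⟩ : Closeds X)).support : Set X) ⊆ (W : Set X) := by
    rw [coe_support_vanishingIdeal]
    rintro y (rfl : y = x)
    exact hxW
  letI algW : Algebra S Γ(X, W) :=
    ((X.presheaf.map (homOfLE (le_top : (W : X.Opens) ≤ ⊤)).op).hom.comp (algebraMapΓ π)).toAlgebra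
  have h1 := PointBlowup.h0_eq_length_quotient π (vanishingIdeal ⟨{x}, hx⟩) ⟨W, hW⟩ hJW
  rw [h1]
  -- `Γ(X, W)/𝓘_{x}(W) ≃ κ(x)` through the evaluation, compatibly with `S`
  have hker : RingHom.ker (X.evaluation W x hxW).hom = (vanishingIdeal ⟨{x}, hx⟩).ideal ⟨W, hW⟩ := by
    rw [ker_evaluation_eq_primeIdealOf hW hxW, ideal_vanishingIdeal_singleton hW hxW hx]
  let e : (Γ(X, W) ⧸ (vanishingIdeal (⟨{x}, hx⟩ : Closeds X)).ideal ⟨W, hW⟩) ≃+* X.residueField x :=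
    (Ideal.quotEquivOfEq hker.symm).trans
      (RingHom.quotientKerEquivOfSurjective (evaluation_surjective_of_isClosed hW hxW hx))
  refine PointBlowup.length_eq_of_ringEquiv e fun s => ?_
  change e (Ideal.Quotient.mk _ (algebraMap S Γ(X, W) s)) = algebraMap S (X.residueField x) s
  change (X.evaluation W x hxW).hom
      (X.presheaf.map (homOfLE (le_top : (W : X.Opens) ≤ ⊤)).op (algebraMapΓ π s)) =
    (X.Γevaluation x).hom (algebraMapΓ π s)
  change (X.presheaf.map (homOfLE (le_top : (W : X.Opens) ≤ ⊤)).op ≫ X.evaluation W x hxW)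
      (algebraMapΓ π s) = _
  rw [Scheme.evaluation, ← Category.assoc, X.presheaf.germ_res (homOfLE (le_top : W ≤ ⊤)) x hxW]
  rfl

variable [IsLocalRing S]

/-- **`length_S κ(x) = [κ(x) : κ(𝔪_S)]`** for a point `x` over the closed point of the local base with finite
residue extension: `S` acts on `κ(x)` through `κ(𝔪_S) = κ(π x)`, onto which `S` surjects, and over a field
length is dimension (Mathlib `Scheme.Hom.residueDegree`, `Module.length_eq_of_surjective`,
`Module.length_eq_finrank`; the computation of `…NoZenoH0LeResidueDegree`). [folklore] -/
theorem length_residueField_eq_residueDegree (hπx : π.base x = closedPoint S) (hdeg : π.residueDegree x ≠ 0) :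
    letI : Algebra S (X.residueField x) := ((X.Γevaluation x).hom.comp (algebraMapΓ π)).toAlgebra
    Module.length S (X.residueField x) = π.residueDegree x := by
  haveI : (π.base x).asIdeal.IsMaximal := by
    rw [hπx]; exact IsLocalRing.maximalIdeal.isMaximal S
  let φ₀ : S →+* (Spec (.of S)).residueField (π.base x) :=
    ((Scheme.ΓSpecIso (.of S)).inv ≫ (Spec (.of S)).Γevaluation (π.base x)).hom
  have hφ₀ : Function.Surjective φ₀ := ΓtoResidueField_surjective_of_isMaximal S (π.base x)
  letI algSK : Algebra S ((Spec (.of S)).residueField (π.base x)) := φ₀.toAlgebra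
  letI algKL : Algebra ((Spec (.of S)).residueField (π.base x)) (X.residueField x) :=
    (π.residueFieldMap x).hom.toAlgebra
  letI algSL : Algebra S (X.residueField x) := ((X.Γevaluation x).hom.comp (algebraMapΓ π)).toAlgebra
  have hcomp : ((X.Γevaluation x).hom.comp (algebraMapΓ π)) = (π.residueFieldMap x).hom.comp φ₀ := by
    ext s
    change (π.appTop ≫ X.Γevaluation x).hom ((Scheme.ΓSpecIso (.of S)).inv.hom s) =
      ((Spec (.of S)).Γevaluation (π.base x) ≫ π.residueFieldMap x).hom ((Scheme.ΓSpecIso (.of S)).inv.hom s)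
    rw [Scheme.Γevaluation_naturality]
  haveI : IsScalarTower S ((Spec (.of S)).residueField (π.base x)) (X.residueField x) :=
    IsScalarTower.of_algebraMap_eq fun s => by
      change ((X.Γevaluation x).hom.comp (algebraMapΓ π)) s = ((π.residueFieldMap x).hom.comp φ₀) s
      rw [hcomp]
  have hdeg' : π.residueDegree x =
      Module.finrank ((Spec (.of S)).residueField (π.base x)) (X.residueField x) := rfl
  haveI : Module.Finite ((Spec (.of S)).residueField (π.base x)) (X.residueField x) :=
    Module.finite_of_finrank_pos (Nat.pos_of_ne_zero (hdeg' ▸ hdeg))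
  rw [Module.length_eq_of_surjective (S := S) (R := (Spec (.of S)).residueField (π.base x)) hφ₀,
    Module.length_eq_finrank, hdeg']

/-- **`h0 π 𝓘_{x} = [κ(x) : κ(𝔪_S)]`**: for `π : X → Spec S` (`S` local) and a closed point `x` over the closed
point with finite residue extension (`π.residueDegree x ≠ 0`), Lipman's `h⁰` of the reduced point is its residue
degree: `h0 π (vanishingIdeal {x}) = π.residueDegree x`. With UP-5a
(`…PointBlowupRegularPoint.h0_comap_vanishingIdeal_point`) this is `h⁰` of the exceptional curve of the blow-up
of `x`, and it is the «residual degree» clause of `Lipman1969_27_1_reg_rat` read at a point. [this work] -/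
theorem h0_vanishingIdeal_singleton_eq_residueDegree (hπx : π.base x = closedPoint S)
    (hdeg : π.residueDegree x ≠ 0) :
    h0 π (vanishingIdeal ⟨{x}, hx⟩) = π.residueDegree x := by
  rw [h0_vanishingIdeal_singleton_eq_length π x hx]
  exact length_residueField_eq_residueDegree π x hπx hdeg

end Point

end Summit.ResolutionOfSingularities.ResolutionOfSingularities.Theorems.NoZeno.ExcCount

end
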